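import Literature.MathematicalPhysics.QuantumFieldTheory.Balaban1983to89.B6Prop22AdjMultiLevelTorus
import Literature.MathematicalPhysics.QuantumFieldTheory.Balaban1983to89.B6Prop22HolderMultiLevelTorus
import Literature.MathematicalPhysics.QuantumFieldTheory.Balaban1983to89.B6Prop22DualHolderMultiLevelBoxRateUnif

/-!
# `Balaban1983to89.B6Prop22DualHolderMultiLevelTorus` — [B6] PROPOSITION 2.2, FIFTH ENTRY OF (2.67) (`‖ζG′∇^{η*}λ‖_α`),
# FOR THE GENUINE `k`-LEVEL OPERATOR `G′ = Δ′_a^{−1}` ON THE TORUS `T_η` (print's carrier, `Ω₁ = T_η`):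
# `|x̂−x|_T^{−α}|(G′∂_μᵀλ)(x̂) − (G′∂_μᵀλ)(x)| ≤ O(1)(L^jη)^{1−α}e^{−½δ₀d_T(y,y′)}|λ|`, `x, x̂ ∈ B^j(y)`, with the PERIODIC
# difference `∂_μ` — by the printed route applied to the transposed fixed point `G′∂ᵀ = G′₀ᵀ∂ᵀ + Rᵀ(G′∂ᵀ)` differenced
# over pairs and lifted to `pairs ⊕ sites`, every cube term read in its translation chart (file T10 of the torus
# carrier; no existing module is touched; no fact is minted)

FRAMING (verbatim cell line):
statement-level skeleton of published theorems with citation tags; proofs where landed; nothing here is a claim about the Yang–Mills mass gap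

Source under audit (cell pub-balaban / lit-balaban): T. Bałaban, *Propagators and renormalization transformations for
lattice gauge theories. II*, Commun. Math. Phys. **96** (1984) 223–250 [`Balaban1984PropagatorsII`, "B6"], p. 234
[PDF 12] (2.64)–(2.67), Proposition 2.2; p. 224 [PDF 2] (2.1)–(2.4) («we admit the case when some domains Ω_j are equal
to T_η»); [3] = T. Bałaban, *Regularity and decay of lattice Green's functions*, Commun. Math. Phys. **89** (1983)
571–597 [`Balaban1983RegularityDecay`], Theorem (1.9) p. 573.  Unit `lit-balaban-p21` (Phase-2 proof seat p21 gen 15),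
HOME `run/shared/lean/pub/lit-balaban/`, B6 fold owner r03, referee ref-4.  Box siblings (consumed BY NAME, untouched):
`B6Prop22DualHolderMultiLevelBox[RateUnif]` (file 13: the lifted identity on `pairs ⊕ sites`, the left
convolution; the `α`-uniform per-term pair bounds `aXt_dd_le_unif`, `bXt_dd_le_unif`, stated for EVERY family of domains on
the fundamental box — hence for every chart), `B6Prop22AdjMultiLevelBox` (`levW`, `conv_left_le`).

## WHAT IS PRINTED (p. 234, verbatim up to notation)

«**Proposition 2.2.** If we have (2.1), (2.2) and M is sufficiently large, then the operator G′ = Δ′_a^{−1} (a = 1)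
satisfies the inequalities |(G′λ)(x)|, |(∇^η_xG′λ)(x)|, |(G′∇^{η*}λ)(x)|, ‖ζ∇^η_xG′λ‖_α, ‖ζG′∇^{η*}λ‖_α, |(Δ^ηG′λ)(x)|
≤ O(1)[(L^jη)², L^jη, L^jη, (L^jη)^{1−α}(‖ζ‖_α + |ζ|), (L^jη)^{1−α}(‖ζ‖_α + |ζ|), 1]·e^{−½δ₀d(y,y′)}|λ|, x ∈ B^j(y) or
supp ζ ⊂ B^j(y), y ∈ Λ_j, supp λ ⊂ B^{j′}(y′), y′ ∈ Λ_{j′}. (2.67)»; p. 224: «Ω₁ ⊃ Ω₂ ⊃ … ⊃ Ω_k, Ω_j ⊂ T_η, j = 1, 2, …, k» (2.1)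
and «we admit the case when some domains Ω_j are equal to T_η».

## WHAT THIS FILE CERTIFIES (kernel-checked; setting of files T1–T7 and T9)

* §1 the same-block pairs of the torus (`BPairT`), the Hölder-weighted difference `(D_αf)(x,x̂) = |x̂−x|_T^{−α}(f(x̂) −
  f(x))` (torus sup-distance), the functional `T(M) = D_α∘M` and **THE LIFTED IDENTITY** `liftL T(G′∂ᵀ) =
  liftL T(G′₀ᵀ∂ᵀ) + liftL D_α∘(RᵀΛ) · liftR (Λ^{−1}G′∂ᵀ)` from the transposed fixed point on the torus (file T7's
  `fixedPoint_transposeT`, `ΛΛ^{−1} = 1`), `∂ = ∂_μ` PERIODIC;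
* §2 **THE PAIR-ROW BOUNDS ON THE TORUS** of `T₀ = D_α∘(G′₀ᵀ∂ᵀ)` (`dualZeroT_rowBound`:
  `A·(L^{j})^{1−α}·e^{−δd_T/(d+1)}|λ|`) and of `Ψ = D_α∘(RᵀΛ)` (`dualPsiT_rowBound`: `(A/M_h)·(L^{j})^{1−α}·e^{−δd_T/(d+1)}
  sup|f|`) — every transported term is the box lineage's term of the central cube of its chart over the RIGIDLY
  translated pair (file T9 §1: `σ⁻¹x̂ − σ⁻¹x = x̂ − x`; file T7: `(σh_□G′(□)v_□σ⁻¹)ᵀ∂_Tᵀ = σ[(h_□G′(□)v_□)ᵀ∂_boxᵀ]σ⁻¹`,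
  `(σKσ⁻¹)ᵀf = σ[Kᵀ(f∘σ)]`), bounded by file 12's `aXt_dd_le` / `bXt_dd_le` on the chart family, the support distance read
  from `d_{chart} ≥ d_T`, at most `3·2^{d+1}` terms keyed at `x` (`M_h ≥ 3`);
* §3 **PROPOSITION 2.2, FIFTH ENTRY, FOR THE GENUINE `k`-LEVEL OPERATOR ON THE TORUS**, with ONE rate `δ₀` and ONE
  threshold for all `α` (`…_unif`, from the box lineage's `α`-uniform per-term rates `aXt_dd_le_unif`, `bXt_dd_le_unif`)
  and the per-`α` forms as corollaries: `hasMajorant_dualHolder_multiLevelTorus` (the lift of `T(G′∂_μᵀ)` has the majorant `C·(L^{j})^{1−α}·e^{−½δ₀d_T(y,y′)}`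
  on `𝔅`: the lifted identity, §2, the third entry on the torus (file T7, conjugated by `Λ^{−1}`), the left convolution
  (2.54)+(2.61) with Lemma 2.1 on the torus (file T3)) and the printed form `prop22_fifth_multiLevelTorus`: for
  `0 ≤ α < 1` there are `δ₀, C, M₀ > 0`, `N₀ ≥ 1` (functions of `d`, `ℓ`, `α`, the windows — NOT of the torus) such that
  for every `k`, `M_h ≥ 3` with `L·M_h ≥ M₀`, `R ≥ 2L` with `RM ≥ N₀ + 1`, torus size `P` (`P_μ ≥ 4`), nested family `D`,
  weights in the windows with `a_{i+1} = aNext ℓ a_i c_i`, axis `μ`, `λ` supported in `B^{j′}(y′)` and all `x ≠ x̂` of one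
  block `B^j(y)`: `|x̂−x|_T^{−α}·|(G′∂_μᵀλ)(x̂) − (G′∂_μᵀλ)(x)| ≤ C·(L^{j})^{1−α}·e^{−½δ₀d_T(y,y′)}·sup|λ|`.

## HONEST SCOPE

As files T1–T7, T9 and the box files 12–13: levels `1 … k`, `Ω₁ = T_η` (no level `0`/`a₀ = +∞`), `m² = 0`, `P_μ ≥ 4`,
asymmetric partition, `M_h ≥ 3`, `R ≥ 2L`, Neumann two-level cube inverses; lattice units (`G′` here is `η^{−2}G′` of
print, `∂ᵀ` the transposed PERIODIC unit difference — `(G′∂ᵀλ)(x) = Σ_z[G′(x,z+e_μ) − G′(x,z)]λ(z)` on `T_η`, i.e.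
`η·G′∇^{η*}` of print up to sign —, whence `(L^{j})^{1−α}` for «(L^jη)^{1−α}»); the Hölder quotient over the pairs
`x ≠ x̂` of ONE block `B^j(y)` (print: «supp ζ ⊂ B^j(y)») with the torus sup-distance (= the lattice distance on a block),
the cut-off `ζ` and the factor `(‖ζ‖_α + |ζ|)` being dispensed with as in [3] (1.9); `0 ≤ α < 1` with rate and constants
depending on `α`; the (2.61)-constant is the `L`-dependent one of `B6Ineq261LevelGap`; «M sufficiently large» is the
third entry's threshold (no iteration).  Nothing is inferred from the manuscript: every step is kernel-checked.
-/

namespace Literature.MathematicalPhysics.QuantumFieldTheory.Balaban1983to89.B6Prop22DualHolderMultiLevelTorus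

open Finset Matrix
open Literature.MathematicalPhysics.QuantumFieldTheory.Balaban1983to89.B4ContourShift (supNorm supNorm_nonneg)
open Literature.MathematicalPhysics.QuantumFieldTheory.Balaban1983to89.B4Reflection242 (boxDom mem_boxDom)
open Literature.MathematicalPhysics.QuantumFieldTheory.Balaban1983to89.B4TorusKernel.MultiPeriod (torusSupNorm
  torusSupNorm_nonneg)
open Literature.MathematicalPhysics.QuantumFieldTheory.Balaban1983to89.B6Ineq243TwoLevelBox (aNext)
open Literature.MathematicalPhysics.QuantumFieldTheory.Balaban1983to89.B6MultiLevelBoxOperator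
open Literature.MathematicalPhysics.QuantumFieldTheory.Balaban1983to89.B6Eq238MultiLevelBox
open Literature.MathematicalPhysics.QuantumFieldTheory.Balaban1983to89.B6Ineq249MultiLevelBox
open Literature.MathematicalPhysics.QuantumFieldTheory.Balaban1983to89.B6Geom246MultiLevelBox
open Literature.MathematicalPhysics.QuantumFieldTheory.Balaban1983to89.B6Prop22MultiLevelBox
open Literature.MathematicalPhysics.QuantumFieldTheory.Balaban1983to89.B6Prop22DerivMultiLevelBox (dMat)
open Literature.MathematicalPhysics.QuantumFieldTheory.Balaban1983to89.B6Prop22AdjMultiLevelBox (levW conv_left_le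
  hasMajorant_diagonal_mul)
open Literature.MathematicalPhysics.QuantumFieldTheory.Balaban1983to89.B6Prop22HolderMultiLevelBox (liftL liftR
  liftL_apply_inl liftL_add liftL_mul_liftR hasMajorant_liftR hasMajorant_liftL rowBound_of_hasMajorant_liftL)
open Literature.MathematicalPhysics.QuantumFieldTheory.Balaban1983to89.B6Prop22DualHolderMultiLevelBoxRateUnif
  (aXt_dd_le_unif bXt_dd_le_unif)
open Literature.MathematicalPhysics.QuantumFieldTheory.Balaban1983to89.B6Prop22DualHolderMultiLevelBox (levW_one_mul_neg_one
  levW_neg_one_eq)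
open Literature.MathematicalPhysics.QuantumFieldTheory.Balaban1983to89.B6RandomWalk (HasMajorant BlockSupp
  hasMajorant_mono hasMajorant_add hasMajorant_mul Triangle254)
open Literature.MathematicalPhysics.QuantumFieldTheory.Balaban1983to89.B6Lemma21Repaired (Ineq261With)
open Literature.MathematicalPhysics.QuantumFieldTheory.Balaban1983to89.B6Ineq261LevelGap (K261 K261_nonneg
  theta_lt_one_of_log)
open Literature.MathematicalPhysics.QuantumFieldTheory.Balaban1983to89.B6MultiLevelTorusOperator
open Literature.MathematicalPhysics.QuantumFieldTheory.Balaban1983to89.B6Eq238MultiLevelTorus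
open Literature.MathematicalPhysics.QuantumFieldTheory.Balaban1983to89.B6Geom246MultiLevelTorus
open Literature.MathematicalPhysics.QuantumFieldTheory.Balaban1983to89.B6Prop22MultiLevelTorus
open Literature.MathematicalPhysics.QuantumFieldTheory.Balaban1983to89.B6Prop22DerivMultiLevelTorus (dT dT_mulVec)
open Literature.MathematicalPhysics.QuantumFieldTheory.Balaban1983to89.B6Prop22AdjMultiLevelTorus (fixedPoint_transposeT
  Dc_lev_apply bTt_mulVec bXt_mulVec_eq_zero_of_uX aTt_mul_dTt aXt_dMatt_mulVec_eq_zero prop22_third_multiLevelTorus)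
open Literature.MathematicalPhysics.QuantumFieldTheory.Balaban1983to89.B6Prop22HolderMultiLevelTorus (σc_symm_sub_of_blkOf
  torusSupNorm_sub_of_blkOf mem_keySet_of_uX_pair)

noncomputable section

variable {d : ℕ}

/-! ## §0 Tools -/

section Tools

/-- a sum over a finite type whose non-zero terms are indexed injectively into a finset `T` and are bounded by
`B ≥ 0` is at most `|T|·B`. [folklore] -/
private theorem sum_le_card_mul {ι σ : Type*} [Fintype ι] [DecidableEq σ] (f : ι → ℝ) (key : ι → σ)
    (hkey : Function.Injective key) (T : Finset σ) (hT : ∀ i, f i ≠ 0 → key i ∈ T) {B : ℝ} (hB : 0 ≤ B)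
    (hf : ∀ i, f i ≤ B) : ∑ i, f i ≤ T.card * B := by
  classical
  rw [← Finset.sum_filter_ne_zero]
  have hcard : (Finset.univ.filter fun i => f i ≠ 0).card ≤ T.card :=
    Finset.card_le_card_of_injOn key (fun i hi => by
      rw [Finset.coe_filter] at hi; exact hT i hi.2) (fun i _ j _ h => hkey h)
  calc ∑ i ∈ Finset.univ.filter (fun i => f i ≠ 0), f i
      ≤ (Finset.univ.filter fun i => f i ≠ 0).card • B := Finset.sum_le_card_nsmul _ _ _ fun i _ => hf i
    _ = ((Finset.univ.filter fun i => f i ≠ 0).card : ℝ) * B := by rw [nsmul_eq_mul]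
    _ ≤ T.card * B := mul_le_mul_of_nonneg_right (by exact_mod_cast hcard) hB

/-- `(reindex e e A)·v` at `z` is `A·(v ∘ e)` at `e⁻¹z`. [folklore] -/
private theorem reindex_mulVec_apply {X Y : Type*} [Fintype X] [Fintype Y] (e : X ≃ Y) (A : Matrix X X ℝ) (v : Y → ℝ)
    (z : Y) : (Matrix.reindex e e A *ᵥ v) z = (A *ᵥ (v ∘ e)) (e.symm z) := by
  rw [Matrix.reindex_apply, Matrix.submatrix_mulVec_equiv, Equiv.symm_symm, Function.comp_apply]

end Tools

/-! ## §1 The same-block pairs of the torus, the Hölder-weighted difference, the functional, the lifted identity -/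

section Pairs

variable {ℓ Mh k R : ℕ} {P : Fin (d + 1) → ℕ}

/-- **THE PAIRS `x ≠ x̂` OF ONE BLOCK OF `𝔅` ON THE TORUS** (the two points of the Hölder quotient of `G′∇^{η*}λ`,
«supp ζ ⊂ B^j(y)»). [cite: Balaban1984PropagatorsII, (2.67) p.234 (fifth entry), p.224 (Ω₁ = T_η), dictionary] -/
structure BPairT (D : TDomains d ℓ Mh k P R) where
  /-- the first point -/
  x : ↥(boxDom (N0 ℓ Mh k P))
  /-- the second point -/
  x' : ↥(boxDom (N0 ℓ Mh k P))
  /-- the points differ -/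
  ne : x'.1 ≠ x.1
  /-- the points lie in one block of `𝔅` -/
  blk : blkOf D.toDomains x' = blkOf D.toDomains x

/-- pairs are determined by their two points. [folklore] -/
private theorem BPairT.ext' {D : TDomains d ℓ Mh k P R} {p q : BPairT D} (hx : p.x = q.x) (hx' : p.x' = q.x') :
    p = q := by
  cases p; cases q
  simp only at hx hx'
  subst hx hx'
  rfl

/-- finitely many pairs. [cite: Balaban1984PropagatorsII, (2.67) p.234, dictionary] -/
instance instFiniteBPairT (D : TDomains d ℓ Mh k P R) : Finite (BPairT D) :=
  Finite.of_injective (fun p : BPairT D => (p.x, p.x')) fun p q h => by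
    simp only [Prod.mk.injEq] at h
    exact BPairT.ext' h.1 h.2

/-- finitely many pairs. [cite: Balaban1984PropagatorsII, (2.67) p.234, dictionary] -/
noncomputable instance instFintypeBPairT (D : TDomains d ℓ Mh k P R) : Fintype (BPairT D) := Fintype.ofFinite _

/-- equality of pairs is decidable (classically). [cite: Balaban1984PropagatorsII, (2.67) p.234, dictionary] -/
noncomputable instance instDecidableEqBPairT (D : TDomains d ℓ Mh k P R) : DecidableEq (BPairT D) := Classical.decEq _

/-- the block of a pair. [cite: Balaban1984PropagatorsII, p.231, dictionary] -/
def blkBT (D : TDomains d ℓ Mh k P R) : BPairT D → ↥(bset D.toDomains) := fun p => blkOf D.toDomains p.x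

/-- **THE HÖLDER-WEIGHTED DIFFERENCE OVER A PAIR ON THE TORUS** (lattice units, torus sup-distance):
`(D_αf)(x, x̂) = |x̂ − x|_T^{−α}·(f(x̂) − f(x))`. [cite: Balaban1984PropagatorsII, (2.67) p.234 (fifth entry ‖ζG′∇^{η*}λ‖_α), dictionary] -/
def DhT (D : TDomains d ℓ Mh k P R) (α : ℝ) : (↥(boxDom (N0 ℓ Mh k P)) → ℝ) →ₗ[ℝ] (BPairT D → ℝ) where
  toFun f p := (torusSupNorm (N0 ℓ Mh k P) (p.x'.1 - p.x.1)) ^ (-α) * (f p.x' - f p.x)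
  map_add' f f' := by
    funext p
    simp only [Pi.add_apply]
    ring
  map_smul' r f := by
    funext p
    simp only [Pi.smul_apply, smul_eq_mul, RingHom.id_apply]
    ring

/-- values of `DhT`. [cite: Balaban1984PropagatorsII, (2.67) p.234 (fifth entry), dictionary] -/
theorem DhT_apply (D : TDomains d ℓ Mh k P R) (α : ℝ) (f : ↥(boxDom (N0 ℓ Mh k P)) → ℝ) (p : BPairT D) :
    DhT D α f p = (torusSupNorm (N0 ℓ Mh k P) (p.x'.1 - p.x.1)) ^ (-α) * (f p.x' - f p.x) := rfl

/-- **THE FUNCTIONAL OF THE FIFTH ENTRY ON THE TORUS** applied to a kernel `M`: `T(M) = D_α ∘ M`.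
[cite: Balaban1984PropagatorsII, (2.67) p.234 (fifth entry), dictionary] -/
def dualOpT (D : TDomains d ℓ Mh k P R) (α : ℝ) (M : Matrix ↥(boxDom (N0 ℓ Mh k P)) ↥(boxDom (N0 ℓ Mh k P)) ℝ) :
    (↥(boxDom (N0 ℓ Mh k P)) → ℝ) →ₗ[ℝ] (BPairT D → ℝ) :=
  DhT D α ∘ₗ Matrix.toLin' M

/-- values of `dualOpT`. [cite: Balaban1984PropagatorsII, (2.67) p.234 (fifth entry), dictionary] -/
theorem dualOpT_apply (D : TDomains d ℓ Mh k P R) (α : ℝ) (M : Matrix ↥(boxDom (N0 ℓ Mh k P)) ↥(boxDom (N0 ℓ Mh k P)) ℝ)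
    (f : ↥(boxDom (N0 ℓ Mh k P)) → ℝ) (p : BPairT D) :
    dualOpT D α M f p = (torusSupNorm (N0 ℓ Mh k P) (p.x'.1 - p.x.1)) ^ (-α) * ((M *ᵥ f) p.x' - (M *ᵥ f) p.x) := by
  unfold dualOpT
  rw [LinearMap.comp_apply, Matrix.toLin'_apply, DhT_apply]

/-- `T(M + M′) = T(M) + T(M′)`. [cite: Balaban1984PropagatorsII, (2.67) p.234 (fifth entry), dictionary] -/
theorem dualOpT_add (D : TDomains d ℓ Mh k P R) (α : ℝ) (M M' : Matrix ↥(boxDom (N0 ℓ Mh k P)) ↥(boxDom (N0 ℓ Mh k P)) ℝ) :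
    dualOpT D α (M + M') = dualOpT D α M + dualOpT D α M' := by
  unfold dualOpT
  rw [map_add, LinearMap.comp_add]

/-- `T(M·M′) = T(M) ∘ M′`. [cite: Balaban1984PropagatorsII, (2.67) p.234 (fifth entry), dictionary] -/
theorem dualOpT_mul (D : TDomains d ℓ Mh k P R) (α : ℝ) (M M' : Matrix ↥(boxDom (N0 ℓ Mh k P)) ↥(boxDom (N0 ℓ Mh k P)) ℝ) :
    dualOpT D α (M * M') = dualOpT D α M ∘ₗ Matrix.toLin' M' := by
  unfold dualOpT
  rw [Matrix.toLin'_mul, LinearMap.comp_assoc]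

/-- **THE LIFTED IDENTITY OF THE FIFTH ENTRY ON THE TORUS** (no iteration): with `V = G′∂ᵀ`, `T = D_α∘V`,
`T₀ = D_α∘(G′₀ᵀ∂ᵀ)`, `Ψ = D_α∘(RᵀΛ)`, `Ṽ = Λ^{−1}V`: `liftL T = liftL T₀ + liftL Ψ · liftR Ṽ` — from the transposed
fixed point `G′∂ᵀ = G′₀ᵀ∂ᵀ + Rᵀ(G′∂ᵀ)` on `T_η` ((2.38)/(2.50), `G′ᵀ = G′`, file T7) and `ΛΛ^{−1} = 1`.
[cite: Balaban1984PropagatorsII, (2.38) p.229, (2.50) p.232, (2.66)–(2.67) p.234 (fifth entry)] -/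
theorem dual_identityT (D : TDomains d ℓ Mh k P R) {a c : ℕ → ℝ} (hℓ : 1 ≤ ℓ) (hR : 2 * (ℓ + 1) ≤ R)
    (hP : ∀ μ, 1 ≤ P μ) (hP4 : ∀ μ, 4 ≤ P μ) (hMh : 1 ≤ Mh) (ha : ∀ i, 1 ≤ i → 0 < a i)
    (hcpos : ∀ i, 1 ≤ i → 0 < c i) (hac : ∀ i, 1 ≤ i → a (i + 1) = aNext ℓ (a i) (c i)) (α : ℝ)
    (Dm : Matrix ↥(boxDom (N0 ℓ Mh k P)) ↥(boxDom (N0 ℓ Mh k P)) ℝ) :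
    liftL (dualOpT D α (gmlT (N0 ℓ Mh k P) ℓ k D.lev a * Dm))
      = liftL (dualOpT D α ((gZeroT D a c hP hP4)ᵀ * Dm))
        + liftL (dualOpT D α ((rT D a c hP hP4)ᵀ * levW D.toDomains 1))
          * liftR (Matrix.toLin' (levW D.toDomains (-1) * (gmlT (N0 ℓ Mh k P) ℓ k D.lev a * Dm))) := by
  have hfix := fixedPoint_transposeT D (c := c) hℓ hR hP hP4 hMh ha hcpos hac Dm
  have hins : (rT D a c hP hP4)ᵀ * (gmlT (N0 ℓ Mh k P) ℓ k D.lev a * Dm)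
      = ((rT D a c hP hP4)ᵀ * levW D.toDomains 1)
        * (levW D.toDomains (-1) * (gmlT (N0 ℓ Mh k P) ℓ k D.lev a * Dm)) := by
    rw [Matrix.mul_assoc, ← Matrix.mul_assoc (levW D.toDomains 1), levW_one_mul_neg_one, Matrix.one_mul]
  conv_lhs => rw [hfix, hins]
  rw [dualOpT_add, dualOpT_mul D α ((rT D a c hP hP4)ᵀ * levW D.toDomains 1), liftL_add, liftL_mul_liftR]

/-- the level weights read through a chart: `(Λf)∘σ = Λ_{chart}(f∘σ)`. [cite: Balaban1984PropagatorsII, (2.67) p.234 (the factor L^jη), (2.3)–(2.4) p.224, dictionary] -/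
theorem levW_mulVec_comp_σc (D : TDomains d ℓ Mh k P R) (j : ℕ) (q : Fin (d + 1) → ℤ)
    (f : ↥(boxDom (N0 ℓ Mh k P)) → ℝ) :
    (levW D.toDomains 1 *ᵥ f) ∘ σc ℓ Mh k P j q = levW (Dc D j q) 1 *ᵥ (f ∘ σc ℓ Mh k P j q) := by
  funext z
  unfold levW
  rw [Function.comp_apply, Matrix.mulVec_diagonal, Matrix.mulVec_diagonal, Function.comp_apply, TDomains.toDomains_lev,
    ← Dc_lev_apply (D := D) j q z]

end Pairs

/-! ## §2 The pair-row bounds of `T₀ = D_α∘(G′₀ᵀ∂ᵀ)` and of `Ψ = D_α∘(RᵀΛ)` on the torus: the sums over the cover -/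

section RowBounds

variable {ℓ Mh k R : ℕ} {P : Fin (d + 1) → ℕ}

/-- **THE PAIR ROWS OF `G′₀ᵀ∂ᵀ`, GENUINE `k`-LEVEL OPERATOR ON THE TORUS, RATE UNIFORM IN `α`**: there is `δ > 0`
(function of `d`, `ℓ`, the windows) and for every `0 ≤ α < 1` an `A > 0` such that for every `k`, `M_h ≥ 3`, `R ≥ 2L`, torus size (`P_μ ≥ 4`), nested
family, weights in the windows, axis `μ`, every `λ` supported in a block `y′` with `|λ| ≤ B` and every pair `(x, x̂)` of
one block `B^j(y)` of the torus:
`|x̂−x|_T^{−α}·|(G′₀ᵀ∂_μᵀλ)(x̂) − (G′₀ᵀ∂_μᵀλ)(x)| ≤ A·(L^{j})^{1−α}·e^{−δd_T(y,y′)/(d+1)}·|λ|` — every transported term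
`(σh_□G′(□)v_□σ⁻¹)ᵀ∂_Tᵀ = σ[(h_□G′(□)v_□)ᵀ∂_boxᵀ]σ⁻¹` over the rigidly translated pair, file 12's `aXt_dd_le` on the
chart family, at most `3·2^{d+1}` terms keyed at `x`. [cite: Balaban1984PropagatorsII, (2.64)–(2.67) p.234 (fifth entry, the G′₀ factor), (2.43) p.230] -/
theorem dualZeroT_rowBound_unif (d ℓ : ℕ) (hℓ : 1 ≤ ℓ) (aminus aplus a2minus a2plus : ℝ) (ha : 0 < aminus)
    (ha2 : 0 < a2minus) :
    ∃ δ : ℝ, 0 < δ ∧ ∀ (α : ℝ), 0 ≤ α → α < 1 → ∃ A : ℝ, 0 < A ∧ ∀ (k Mh R : ℕ), 3 ≤ Mh → 2 * (ℓ + 1) ≤ R →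
      ∀ (P : Fin (d + 1) → ℕ) (hP : ∀ μ, 1 ≤ P μ) (hP4 : ∀ μ, 4 ≤ P μ) (D : TDomains d ℓ Mh k P R) (a c : ℕ → ℝ),
        (∀ i, 1 ≤ i → aminus ≤ a i ∧ a i ≤ aplus) → (∀ i, 1 ≤ i → a2minus ≤ c i ∧ c i ≤ a2plus) →
        ∀ (μ : Fin (d + 1)) (y' : ↥(bset D.toDomains)) (lam : ↥(boxDom (N0 ℓ Mh k P)) → ℝ) (B : ℝ),
          BlockSupp (g := geomT D) (blkOf D.toDomains) lam y' B → ∀ p : BPairT D,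
          |dualOpT D α ((gZeroT D a c hP hP4)ᵀ * (dT (N0 ℓ Mh k P) μ)ᵀ) lam p|
            ≤ A * (((ℓ : ℝ) + 1) ^ (blkBT D p).1.1) ^ (1 - α)
              * Real.exp (-(δ / (d + 1) * (geomT D).dist (blkBT D p) y')) * B := by
  obtain ⟨δ₅, hδ₅, hQA⟩ := aXt_dd_le_unif d ℓ hℓ aminus aplus a2minus a2plus ha ha2
  refine ⟨δ₅, hδ₅, fun α hα0 hα1 => ?_⟩
  obtain ⟨Q, hQ, hbox⟩ := hQA α hα0 hα1
  refine ⟨3 * 2 ^ (d + 1) * Q + 1, by positivity, ?_⟩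
  intro k Mh R hMh hR P hP hP4 D a c haw hcw μ y' lam B hlam p
  have hMh1 : 1 ≤ Mh := le_trans (by norm_num) hMh
  have hB0 : 0 ≤ B := hlam.nonneg
  have hlev : (blkBT D p).1.1 = D.lev p.x.1 := rfl
  have hblkB : blkBT D p = blkOf D.toDomains p.x := rfl
  rw [hlev, hblkB]
  set dist0 : ℝ := (((bondT D).dist (blkOf D.toDomains p.x) y' : ℕ) : ℝ) with hdist0
  have hgeom : (geomT D).dist (blkOf D.toDomains p.x) y' = dist0 := rfl
  rw [hgeom]
  obtain ⟨E5, hE5⟩ : ∃ t : ℝ, t = Real.exp (-(δ₅ / (d + 1) * dist0)) := ⟨_, rfl⟩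
  obtain ⟨LJ, hLJ⟩ : ∃ t : ℝ, t = (((ℓ : ℝ) + 1) ^ D.lev p.x.1) ^ (1 - α) := ⟨_, rfl⟩
  rw [← hE5, ← hLJ]
  have hE50 : 0 ≤ E5 := by rw [hE5]; exact (Real.exp_pos _).le
  have hLJ0 : 0 ≤ LJ := by rw [hLJ]; exact Real.rpow_nonneg (by positivity) _
  have hWeq : torusSupNorm (N0 ℓ Mh k P) (p.x'.1 - p.x.1) = supNorm (p.x'.1 - p.x.1) :=
    torusSupNorm_sub_of_blkOf hMh1 hP4 p.blk
  have hs0 : 0 < supNorm (p.x'.1 - p.x.1) :=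
    lt_of_lt_of_le one_pos (B4StripSumsHolder.one_le_supNorm (sub_ne_zero.2 p.ne))
  have hW0 : 0 ≤ (supNorm (p.x'.1 - p.x.1)) ^ (-α) := Real.rpow_nonneg hs0.le _
  -- one term
  obtain ⟨E, hE⟩ : ∃ t : ℝ, t = LJ * (Q * E5 * B) := ⟨_, rfl⟩
  have hEnn : 0 ≤ E := by rw [hE]; positivity
  have hone : ∀ (cq : ℕ × (Fin (d + 1) → ℤ)) (hc : CubeDataT D cq),
      |(supNorm (p.x'.1 - p.x.1)) ^ (-α)
        * ((((aT D a c hP hP4 cq hc)ᵀ * (dT (N0 ℓ Mh k P) μ)ᵀ) *ᵥ lam) p.x'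
          - (((aT D a c hP hP4 cq hc)ᵀ * (dT (N0 ℓ Mh k P) μ)ᵀ) *ᵥ lam) p.x)| ≤ E := by
    intro cq hc
    set σ := σc ℓ Mh k P cq.1 cq.2 with hσ
    set w : ↥(boxDom (N0 ℓ Mh k P)) := σ.symm p.x with hw
    set w' : ↥(boxDom (N0 ℓ Mh k P)) := σ.symm p.x' with hw'
    have hcc := cubeData_chart (D := D) hP4 hc
    obtain ⟨b, hb⟩ := blkMap_surjective (D := D) hMh1 hP (svec ℓ k cq.1 cq.2) y'
    have hlam' : BlockSupp (g := geom (Dc D cq.1 cq.2)) (blkOf (Dc D cq.1 cq.2)) (lam ∘ σ) b B :=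
      blockSupp_chart hMh1 hP (svec ℓ k cq.1 cq.2) hlam hb
    rw [aTt_mul_dTt hMh1 hP hP4 cq hc μ, reindex_mulVec_apply, reindex_mulVec_apply, ← hw, ← hw']
    have hblkc : blkOf (Dc D cq.1 cq.2) w' = blkOf (Dc D cq.1 cq.2) w := by
      apply blkMap_injective (D := D) hMh1 hP (svec ℓ k cq.1 cq.2)
      unfold Dc
      rw [blkMap_blkOf hMh1 hP, blkMap_blkOf hMh1 hP, hw, hw', hσ]
      unfold σc
      rw [Equiv.apply_symm_apply, Equiv.apply_symm_apply]
      exact p.blk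
    have hdiff : w'.1 - w.1 = p.x'.1 - p.x.1 := by
      rw [hw, hw', hσ]; exact σc_symm_sub_of_blkOf hMh1 hP cq.1 cq.2 p.blk
    have hne : w'.1 ≠ w.1 := fun h0 => p.ne (sub_eq_zero.1 (by rw [← hdiff, h0, sub_self]))
    rw [← hdiff]
    have h := hbox k Mh R hMh hR P hP (Dc D cq.1 cq.2) a c haw hcw μ b (lam ∘ σ) B hlam' w w' hne hblkc
      (cq.1, qc ℓ k cq.1 cq.2) hcc
    rw [abs_mul, abs_of_nonneg (by rw [hdiff]; exact hW0)]
    refine h.trans ?_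
    have hlevc : (Dc D cq.1 cq.2).lev w.1 = D.lev p.x.1 := by rw [hw, hσ]; exact Dc_lev_symm D cq.1 cq.2 p.x
    rw [hlevc, ← hLJ, hE]
    have hd : dist0 ≤ (((bond (Dc D cq.1 cq.2)).dist (blkOf (Dc D cq.1 cq.2) w) b : ℕ) : ℝ) := by
      rw [hdist0, ← hb, hw, hσ]
      exact_mod_cast distT_blkOf_le_chart hMh1 hP (svec ℓ k cq.1 cq.2) p.x b
    have hexp : Real.exp (-(δ₅ / (d + 1) * (geom (Dc D cq.1 cq.2)).dist (blkOf (Dc D cq.1 cq.2) w) b)) ≤ E5 := by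
      rw [hE5, Real.exp_le_exp, neg_le_neg_iff]
      exact mul_le_mul_of_nonneg_left hd (by positivity)
    have : Q * Real.exp (-(δ₅ / (d + 1) * (geom (Dc D cq.1 cq.2)).dist (blkOf (Dc D cq.1 cq.2) w) b)) * B
        ≤ Q * E5 * B :=
      mul_le_mul_of_nonneg_right (mul_le_mul_of_nonneg_left hexp hQ.le) hB0
    exact mul_le_mul_of_nonneg_left this hLJ0
  -- the sum over the cover
  rw [dualOpT_apply, hWeq]
  unfold gZeroT
  rw [Matrix.transpose_sum, Finset.sum_mul, Matrix.sum_mulVec, Finset.sum_apply, Finset.sum_apply,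
    ← Finset.sum_sub_distrib, Finset.mul_sum, Finset.attach_eq_univ]
  refine (Finset.abs_sum_le_sum_abs _ _).trans ?_
  have key := sum_le_card_mul
    (fun cq : {cq // cq ∈ cubeSetT D} => |(supNorm (p.x'.1 - p.x.1)) ^ (-α)
        * ((((aT D a c hP hP4 cq.1 (cubeDataT_of_mem cq.2))ᵀ * (dT (N0 ℓ Mh k P) μ)ᵀ) *ᵥ lam) p.x'
          - (((aT D a c hP hP4 cq.1 (cubeDataT_of_mem cq.2))ᵀ * (dT (N0 ℓ Mh k P) μ)ᵀ) *ᵥ lam) p.x)|)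
    (fun cq => (cq.1.1, Qmap ℓ Mh k P cq.1.1 p.x.1 cq.1.2)) (keyT_injective D p.x.1) (keySet ℓ Mh (D.lev p.x.1) p.x.1)
    (fun cq hq0 => by
      have hcc := cubeData_chart (D := D) hP4 (cubeDataT_of_mem cq.2)
      set σ := σc ℓ Mh k P cq.1.1 cq.1.2 with hσ
      set w : ↥(boxDom (N0 ℓ Mh k P)) := σ.symm p.x with hw
      set w' : ↥(boxDom (N0 ℓ Mh k P)) := σ.symm p.x' with hw'
      have hblkc : blkOf (Dc D cq.1.1 cq.1.2) w' = blkOf (Dc D cq.1.1 cq.1.2) w := by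
        apply blkMap_injective (D := D) hMh1 hP (svec ℓ k cq.1.1 cq.1.2)
        unfold Dc
        rw [blkMap_blkOf hMh1 hP, blkMap_blkOf hMh1 hP, hw, hw', hσ]
        unfold σc
        rw [Equiv.apply_symm_apply, Equiv.apply_symm_apply]
        exact p.blk
      by_contra hmem
      apply hq0
      have hzero : ∀ v : ↥(boxDom (N0 ℓ Mh k P)), (v = w ∨ v = w') →
          uX (ℓ := ℓ) (Mh := Mh) (k := k) (P := P) (cq.1.1, qc ℓ k cq.1.1 cq.1.2) v = 0 := by
        intro v hv0
        by_contra hu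
        have hvw : blkOf (Dc D cq.1.1 cq.1.2) v = blkOf (Dc D cq.1.1 cq.1.2) w := by
          rcases hv0 with h0 | h0
          · rw [h0]
          · rw [h0]; exact hblkc
        have hk := mem_keySet_of_uX_pair hℓ hR hP hP4 hMh (cubeDataT_of_mem cq.2) μ hvw (Or.inl rfl) hu
        have hlevc : (Dc D cq.1.1 cq.1.2).lev w.1 = D.lev p.x.1 := by
          rw [hw, hσ]; exact Dc_lev_symm D cq.1.1 cq.1.2 p.x
        rw [hlevc, hw, hσ] at hk
        exact hmem (mem_keySet_chart hMh1 (cubeDataT_of_mem cq.2).hj.2 hk)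
      rw [aTt_mul_dTt hMh1 hP hP4 cq.1 (cubeDataT_of_mem cq.2) μ, reindex_mulVec_apply, reindex_mulVec_apply,
        ← hw, ← hw', aXt_dMatt_mulVec_eq_zero hP _ hcc μ _ (hzero w (Or.inl rfl)),
        aXt_dMatt_mulVec_eq_zero hP _ hcc μ _ (hzero w' (Or.inr rfl))]
      simp only [sub_self, mul_zero, abs_zero])
    hEnn (fun cq => hone cq.1 (cubeDataT_of_mem cq.2))
  refine key.trans ?_
  have hcard : ((keySet ℓ Mh (D.lev p.x.1) p.x.1).card : ℝ) ≤ 3 * 2 ^ (d + 1) := by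
    exact_mod_cast card_keySet_le _ _ _ _
  calc ((keySet ℓ Mh (D.lev p.x.1) p.x.1).card : ℝ) * E ≤ 3 * 2 ^ (d + 1) * E :=
        mul_le_mul_of_nonneg_right hcard hEnn
    _ = 3 * 2 ^ (d + 1) * Q * LJ * E5 * B := by rw [hE]; ring
    _ ≤ (3 * 2 ^ (d + 1) * Q + 1) * LJ * E5 * B := by
        have : 0 ≤ LJ * E5 * B := by positivity
        nlinarith

/-- **THE PAIR ROWS OF `RᵀΛ` ARE `O(M_h^{−1})`, GENUINE `k`-LEVEL OPERATOR ON THE TORUS, RATE UNIFORM IN `α`**: there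
is `δ > 0` and for every `0 ≤ α < 1` an `A > 0` such that (same quantifiers) `|x̂−x|_T^{−α}·|(RᵀΛf)(x̂) − (RᵀΛf)(x)| ≤ (A/M_h)·(L^{j})^{1−α}·e^{−δd_T(y,y′)/(d+1)}
·sup|f|` — every transported term `(σK(h_□)G′(□)v_□σ⁻¹)ᵀ(Λf) = σ[(K(h_□)G′(□)v_□)ᵀ(Λ_{chart}(f∘σ))]σ⁻¹` over the rigidly
translated pair, file 12's `bXt_dd_le` on the chart family, at most `3·2^{d+1}` terms keyed at `x`.
[cite: Balaban1984PropagatorsII, (2.44) p.230, (2.49)/(2.51) p.232, (2.64)–(2.67) p.234 (fifth entry)] -/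
theorem dualPsiT_rowBound_unif (d ℓ : ℕ) (hℓ : 1 ≤ ℓ) (aminus aplus a2minus a2plus : ℝ) (ha : 0 < aminus)
    (ha2 : 0 < a2minus) :
    ∃ δ : ℝ, 0 < δ ∧ ∀ (α : ℝ), 0 ≤ α → α < 1 → ∃ A : ℝ, 0 < A ∧ ∀ (k Mh R : ℕ), 3 ≤ Mh → 2 * (ℓ + 1) ≤ R →
      ∀ (P : Fin (d + 1) → ℕ) (hP : ∀ μ, 1 ≤ P μ) (hP4 : ∀ μ, 4 ≤ P μ) (D : TDomains d ℓ Mh k P R) (a c : ℕ → ℝ),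
        (∀ i, 1 ≤ i → aminus ≤ a i ∧ a i ≤ aplus) → (∀ i, 1 ≤ i → a2minus ≤ c i ∧ c i ≤ a2plus) →
        ∀ (y' : ↥(bset D.toDomains)) (lam : ↥(boxDom (N0 ℓ Mh k P)) → ℝ) (B : ℝ),
          BlockSupp (g := geomT D) (blkOf D.toDomains) lam y' B → ∀ p : BPairT D,
          |dualOpT D α ((rT D a c hP hP4)ᵀ * levW D.toDomains 1) lam p|
            ≤ A / Mh * (((ℓ : ℝ) + 1) ^ (blkBT D p).1.1) ^ (1 - α)
              * Real.exp (-(δ / (d + 1) * (geomT D).dist (blkBT D p) y')) * B := by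
  obtain ⟨δ₆, hδ₆, hQA⟩ := bXt_dd_le_unif d ℓ hℓ aminus aplus a2minus a2plus ha ha2
  refine ⟨δ₆, hδ₆, fun α hα0 hα1 => ?_⟩
  obtain ⟨Q, hQ, hbox⟩ := hQA α hα0 hα1
  refine ⟨3 * 2 ^ (d + 1) * Q + 1, by positivity, ?_⟩
  intro k Mh R hMh hR P hP hP4 D a c haw hcw y' lam B hlam p
  have hMh1 : 1 ≤ Mh := le_trans (by norm_num) hMh
  have hMhr : (1 : ℝ) ≤ Mh := by exact_mod_cast hMh1
  have hMh0 : (0 : ℝ) < Mh := by linarith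
  have hB0 : 0 ≤ B := hlam.nonneg
  have hlev : (blkBT D p).1.1 = D.lev p.x.1 := rfl
  have hblkB : blkBT D p = blkOf D.toDomains p.x := rfl
  rw [hlev, hblkB]
  set dist0 : ℝ := (((bondT D).dist (blkOf D.toDomains p.x) y' : ℕ) : ℝ) with hdist0
  have hgeom : (geomT D).dist (blkOf D.toDomains p.x) y' = dist0 := rfl
  rw [hgeom]
  obtain ⟨E6, hE6⟩ : ∃ t : ℝ, t = Real.exp (-(δ₆ / (d + 1) * dist0)) := ⟨_, rfl⟩
  obtain ⟨LJ, hLJ⟩ : ∃ t : ℝ, t = (((ℓ : ℝ) + 1) ^ D.lev p.x.1) ^ (1 - α) := ⟨_, rfl⟩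
  rw [← hE6, ← hLJ]
  have hE60 : 0 ≤ E6 := by rw [hE6]; exact (Real.exp_pos _).le
  have hLJ0 : 0 ≤ LJ := by rw [hLJ]; exact Real.rpow_nonneg (by positivity) _
  have hWeq : torusSupNorm (N0 ℓ Mh k P) (p.x'.1 - p.x.1) = supNorm (p.x'.1 - p.x.1) :=
    torusSupNorm_sub_of_blkOf hMh1 hP4 p.blk
  have hs0 : 0 < supNorm (p.x'.1 - p.x.1) :=
    lt_of_lt_of_le one_pos (B4StripSumsHolder.one_le_supNorm (sub_ne_zero.2 p.ne))
  have hW0 : 0 ≤ (supNorm (p.x'.1 - p.x.1)) ^ (-α) := Real.rpow_nonneg hs0.le _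
  obtain ⟨g, hgdef⟩ : ∃ t : ↥(boxDom (N0 ℓ Mh k P)) → ℝ, t = levW D.toDomains 1 *ᵥ lam := ⟨_, rfl⟩
  -- one term
  obtain ⟨E, hE⟩ : ∃ t : ℝ, t = LJ * (Q / Mh * E6 * B) := ⟨_, rfl⟩
  have hEnn : 0 ≤ E := by rw [hE]; positivity
  have hone : ∀ (cq : ℕ × (Fin (d + 1) → ℤ)) (hc : CubeDataT D cq),
      |(supNorm (p.x'.1 - p.x.1)) ^ (-α)
        * (((bT D a c hP hP4 cq hc)ᵀ *ᵥ g) p.x' - ((bT D a c hP hP4 cq hc)ᵀ *ᵥ g) p.x)| ≤ E := by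
    intro cq hc
    set σ := σc ℓ Mh k P cq.1 cq.2 with hσ
    set w : ↥(boxDom (N0 ℓ Mh k P)) := σ.symm p.x with hw
    set w' : ↥(boxDom (N0 ℓ Mh k P)) := σ.symm p.x' with hw'
    have hcc := cubeData_chart (D := D) hP4 hc
    obtain ⟨b, hb⟩ := blkMap_surjective (D := D) hMh1 hP (svec ℓ k cq.1 cq.2) y'
    have hlam' : BlockSupp (g := geom (Dc D cq.1 cq.2)) (blkOf (Dc D cq.1 cq.2)) (lam ∘ σ) b B :=
      blockSupp_chart hMh1 hP (svec ℓ k cq.1 cq.2) hlam hb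
    rw [bTt_mulVec hP hP4 cq hc g p.x, bTt_mulVec hP hP4 cq hc g p.x', ← hσ, ← hw, ← hw', hgdef,
      levW_mulVec_comp_σc D cq.1 cq.2 lam]
    have hblkc : blkOf (Dc D cq.1 cq.2) w' = blkOf (Dc D cq.1 cq.2) w := by
      apply blkMap_injective (D := D) hMh1 hP (svec ℓ k cq.1 cq.2)
      unfold Dc
      rw [blkMap_blkOf hMh1 hP, blkMap_blkOf hMh1 hP, hw, hw', hσ]
      unfold σc
      rw [Equiv.apply_symm_apply, Equiv.apply_symm_apply]
      exact p.blk
    have hdiff : w'.1 - w.1 = p.x'.1 - p.x.1 := by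
      rw [hw, hw', hσ]; exact σc_symm_sub_of_blkOf hMh1 hP cq.1 cq.2 p.blk
    have hne : w'.1 ≠ w.1 := fun h0 => p.ne (sub_eq_zero.1 (by rw [← hdiff, h0, sub_self]))
    rw [← hdiff]
    have h := hbox k Mh R hMh hR P hP (Dc D cq.1 cq.2) a c haw hcw b (lam ∘ σ) B hlam' w w' hne hblkc
      (cq.1, qc ℓ k cq.1 cq.2) hcc
    rw [abs_mul, abs_of_nonneg (by rw [hdiff]; exact hW0), ← hσ]
    refine h.trans ?_
    have hlevc : (Dc D cq.1 cq.2).lev w.1 = D.lev p.x.1 := by rw [hw, hσ]; exact Dc_lev_symm D cq.1 cq.2 p.x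
    rw [hlevc, ← hLJ, hE]
    have hd : dist0 ≤ (((bond (Dc D cq.1 cq.2)).dist (blkOf (Dc D cq.1 cq.2) w) b : ℕ) : ℝ) := by
      rw [hdist0, ← hb, hw, hσ]
      exact_mod_cast distT_blkOf_le_chart hMh1 hP (svec ℓ k cq.1 cq.2) p.x b
    have hexp : Real.exp (-(δ₆ / (d + 1) * (geom (Dc D cq.1 cq.2)).dist (blkOf (Dc D cq.1 cq.2) w) b)) ≤ E6 := by
      rw [hE6, Real.exp_le_exp, neg_le_neg_iff]
      exact mul_le_mul_of_nonneg_left hd (by positivity)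
    have : Q / Mh * Real.exp (-(δ₆ / (d + 1) * (geom (Dc D cq.1 cq.2)).dist (blkOf (Dc D cq.1 cq.2) w) b)) * B
        ≤ Q / Mh * E6 * B :=
      mul_le_mul_of_nonneg_right (mul_le_mul_of_nonneg_left hexp (by positivity)) hB0
    exact mul_le_mul_of_nonneg_left this hLJ0
  -- the sum over the cover
  rw [dualOpT_apply, hWeq, ← Matrix.mulVec_mulVec, ← hgdef]
  unfold rT
  rw [Matrix.transpose_sum, Matrix.sum_mulVec, Finset.sum_apply, Finset.sum_apply, ← Finset.sum_sub_distrib,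
    Finset.mul_sum, Finset.attach_eq_univ]
  refine (Finset.abs_sum_le_sum_abs _ _).trans ?_
  have key := sum_le_card_mul
    (fun cq : {cq // cq ∈ cubeSetT D} => |(supNorm (p.x'.1 - p.x.1)) ^ (-α)
        * (((bT D a c hP hP4 cq.1 (cubeDataT_of_mem cq.2))ᵀ *ᵥ g) p.x'
          - ((bT D a c hP hP4 cq.1 (cubeDataT_of_mem cq.2))ᵀ *ᵥ g) p.x)|)
    (fun cq => (cq.1.1, Qmap ℓ Mh k P cq.1.1 p.x.1 cq.1.2)) (keyT_injective D p.x.1) (keySet ℓ Mh (D.lev p.x.1) p.x.1)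
    (fun cq hq0 => by
      have hcc := cubeData_chart (D := D) hP4 (cubeDataT_of_mem cq.2)
      set σ := σc ℓ Mh k P cq.1.1 cq.1.2 with hσ
      set w : ↥(boxDom (N0 ℓ Mh k P)) := σ.symm p.x with hw
      set w' : ↥(boxDom (N0 ℓ Mh k P)) := σ.symm p.x' with hw'
      have hblkc : blkOf (Dc D cq.1.1 cq.1.2) w' = blkOf (Dc D cq.1.1 cq.1.2) w := by
        apply blkMap_injective (D := D) hMh1 hP (svec ℓ k cq.1.1 cq.1.2)
        unfold Dc
        rw [blkMap_blkOf hMh1 hP, blkMap_blkOf hMh1 hP, hw, hw', hσ]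
        unfold σc
        rw [Equiv.apply_symm_apply, Equiv.apply_symm_apply]
        exact p.blk
      by_contra hmem
      apply hq0
      have hzero : ∀ v : ↥(boxDom (N0 ℓ Mh k P)), (v = w ∨ v = w') →
          uX (ℓ := ℓ) (Mh := Mh) (k := k) (P := P) (cq.1.1, qc ℓ k cq.1.1 cq.1.2) v = 0 := by
        intro v hv0
        by_contra hu
        have hvw : blkOf (Dc D cq.1.1 cq.1.2) v = blkOf (Dc D cq.1.1 cq.1.2) w := by
          rcases hv0 with h0 | h0
          · rw [h0]
          · rw [h0]; exact hblkc
        have hk := mem_keySet_of_uX_pair hℓ hR hP hP4 hMh (cubeDataT_of_mem cq.2) 0 hvw (Or.inl rfl) hu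
        have hlevc : (Dc D cq.1.1 cq.1.2).lev w.1 = D.lev p.x.1 := by
          rw [hw, hσ]; exact Dc_lev_symm D cq.1.1 cq.1.2 p.x
        rw [hlevc, hw, hσ] at hk
        exact hmem (mem_keySet_chart hMh1 (cubeDataT_of_mem cq.2).hj.2 hk)
      rw [bTt_mulVec hP hP4 cq.1 (cubeDataT_of_mem cq.2) g p.x, bTt_mulVec hP hP4 cq.1 (cubeDataT_of_mem cq.2) g p.x',
        ← hσ, ← hw, ← hw',
        bXt_mulVec_eq_zero_of_uX (a := a) (c := c) hP _ hcc _ (hzero w (Or.inl rfl)),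
        bXt_mulVec_eq_zero_of_uX (a := a) (c := c) hP _ hcc _ (hzero w' (Or.inr rfl))]
      simp only [sub_self, mul_zero, abs_zero])
    hEnn (fun cq => hone cq.1 (cubeDataT_of_mem cq.2))
  refine key.trans ?_
  have hcard : ((keySet ℓ Mh (D.lev p.x.1) p.x.1).card : ℝ) ≤ 3 * 2 ^ (d + 1) := by
    exact_mod_cast card_keySet_le _ _ _ _
  calc ((keySet ℓ Mh (D.lev p.x.1) p.x.1).card : ℝ) * E ≤ 3 * 2 ^ (d + 1) * E :=
        mul_le_mul_of_nonneg_right hcard hEnn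
    _ = (3 * 2 ^ (d + 1) * Q) / Mh * LJ * E6 * B := by rw [hE]; ring
    _ ≤ (3 * 2 ^ (d + 1) * Q + 1) / Mh * LJ * E6 * B := by
        have : 0 ≤ LJ * E6 * B := by positivity
        have h1 : (3 * 2 ^ (d + 1) * Q) / Mh ≤ (3 * 2 ^ (d + 1) * Q + 1) / Mh :=
          div_le_div_of_nonneg_right (by linarith) hMh0.le
        calc (3 * 2 ^ (d + 1) * Q) / Mh * LJ * E6 * B = (3 * 2 ^ (d + 1) * Q) / Mh * (LJ * E6 * B) := by ring
          _ ≤ (3 * 2 ^ (d + 1) * Q + 1) / Mh * (LJ * E6 * B) := mul_le_mul_of_nonneg_right h1 this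
          _ = _ := by ring

end RowBounds

/-! ## §3 Proposition 2.2, fifth entry, for the genuine `k`-level operator on the torus -/

section Prop22

variable {ℓ Mh k R : ℕ} {P : Fin (d + 1) → ℕ}

/-- **THE LIFTED FIFTH ENTRY HAS A MAJORANT** `C_α·(L^{j})^{1−α}·e^{−½δ₀d_T(y,y′)}` on `𝔅` (pairs of `B^j(y)` as rows), for
the genuine `k`-level operator on the torus, WITH ONE RATE AND ONE THRESHOLD FOR ALL `α`: there are `δ₀, M₀ > 0`,
`N₀ ≥ 1` (functions of `d`, `ℓ`, the windows) and for every `0 ≤ α < 1` a `C_α > 0` such that for every `k`, `M_h ≥ 3` with `L·M_h ≥ M₀`, `R ≥ 2L` with `RM ≥ N₀ + 1`, torus size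
(`P_μ ≥ 4`), nested family `D`, weights in the windows with `a_{i+1} = aNext ℓ a_i c_i` and axis `μ`, the lift of
`T = D_α∘(G′∂_μᵀ)` (`G′ = Δ′_a^{−1}` on `T_η`, `∂_μ` periodic) has that majorant — the lifted identity `T = T₀ + Ψ·Ṽ`
(§1), the pair-row bounds of `T₀` and `Ψ` (§2), the majorant of `Ṽ = Λ^{−1}G′∂ᵀ` (the third entry on the torus, file
T7, conjugated by `Λ^{−1}`), the left convolution (2.54)+(2.61) and Lemma 2.1 on the torus (file T3).
[cite: Balaban1984PropagatorsII, Proposition 2.2 (2.67) p.234 (fifth entry), (2.64)–(2.66) p.234, p.224 (Ω₁ = T_η admitted)] -/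
theorem hasMajorant_dualHolder_multiLevelTorus_unif (d ℓ : ℕ) (hℓ : 1 ≤ ℓ) (aminus aplus a2minus a2plus : ℝ)
    (ha : 0 < aminus) (ha2 : 0 < a2minus) :
    ∃ δ₀ M₀ : ℝ, ∃ N₀ : ℕ, 0 < δ₀ ∧ 0 < M₀ ∧ 0 < N₀ ∧ ∀ (α : ℝ), 0 ≤ α → α < 1 → ∃ C : ℝ, 0 < C ∧
      ∀ (k Mh R : ℕ), 3 ≤ Mh → M₀ ≤ ((ℓ : ℝ) + 1) * Mh → 2 * (ℓ + 1) ≤ R → N₀ + 1 ≤ R * ((ℓ + 1) * Mh) →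
      ∀ (P : Fin (d + 1) → ℕ) (hP : ∀ μ, 1 ≤ P μ) (hP4 : ∀ μ, 4 ≤ P μ) (D : TDomains d ℓ Mh k P R) (a c : ℕ → ℝ),
        (∀ i, 1 ≤ i → aminus ≤ a i ∧ a i ≤ aplus) → (∀ i, 1 ≤ i → a2minus ≤ c i ∧ c i ≤ a2plus) →
        (∀ i, 1 ≤ i → a (i + 1) = aNext ℓ (a i) (c i)) → ∀ μ : Fin (d + 1),
        HasMajorant (g := geomT D) (Sum.elim (blkBT D) (blkOf D.toDomains))
          (liftL (dualOpT D α (gmlT (N0 ℓ Mh k P) ℓ k D.lev a * (dT (N0 ℓ Mh k P) μ)ᵀ)))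
          (fun y y' => C * (((ℓ : ℝ) + 1) ^ y.1.1) ^ (1 - α) * Real.exp (-(δ₀ / 2 * (geomT D).dist y y'))) := by
  obtain ⟨δV, CV, M₀V, N₀V, hδV, hCV, hM₀V, hN₀V, hV⟩ :=
    prop22_third_multiLevelTorus d ℓ hℓ aminus aplus a2minus a2plus ha ha2
  obtain ⟨δZ, hδZ, hZA⟩ := dualZeroT_rowBound_unif d ℓ hℓ aminus aplus a2minus a2plus ha ha2
  obtain ⟨δΨ, hδΨ, hΨA⟩ := dualPsiT_rowBound_unif d ℓ hℓ aminus aplus a2minus a2plus ha ha2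
  have hL0 : (0 : ℝ) < (ℓ : ℝ) + 1 := by positivity
  have hL1 : (1 : ℝ) ≤ (ℓ : ℝ) + 1 := by linarith [(Nat.cast_nonneg ℓ : (0 : ℝ) ≤ ℓ)]
  -- the common rate
  set δ₀ : ℝ := min (δV / 2) (min δZ δΨ / (d + 1)) with hδ₀
  have hδ₀pos : 0 < δ₀ := by rw [hδ₀]; exact lt_min (half_pos hδV) (div_pos (lt_min hδZ hδΨ) (by positivity))
  have hδ₀V : δ₀ ≤ δV / 2 := by rw [hδ₀]; exact min_le_left _ _
  have hδ₀Z : δ₀ ≤ δZ / (d + 1) := by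
    rw [hδ₀]; exact (min_le_right _ _).trans (div_le_div_of_nonneg_right (min_le_left _ _) (by positivity))
  have hδ₀Ψ : δ₀ ≤ δΨ / (d + 1) := by
    rw [hδ₀]; exact (min_le_right _ _).trans (div_le_div_of_nonneg_right (min_le_right _ _) (by positivity))
  -- the (2.59)-threshold (ours and the third entry's)
  set N₀ : ℕ := ⌈4 * ((d : ℝ) + 1) * ((ℓ : ℝ) + 1) / (1 / 2 * δ₀)⌉₊ + 1 + N₀V with hN₀
  have hN₀pos : 0 < N₀ := by rw [hN₀]; omega
  have hθlt : Real.exp (-(1 / 2 * δ₀)) * ((ℓ : ℝ) + 1) ^ ((2 * (d + 1 : ℕ) : ℝ) / N₀) < 1 := by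
    refine theta_lt_one_of_log hL0 hN₀pos ?_
    have hlog : Real.log ((ℓ : ℝ) + 1) ≤ (ℓ : ℝ) + 1 := (Real.log_le_sub_one_of_pos hL0).trans (by linarith)
    have hN₀ge : 4 * ((d : ℝ) + 1) * ((ℓ : ℝ) + 1) / (1 / 2 * δ₀) < (N₀ : ℝ) := by
      rw [hN₀]; push_cast
      have h0 : (0 : ℝ) ≤ (N₀V : ℝ) := Nat.cast_nonneg _
      exact lt_of_le_of_lt (Nat.le_ceil _) (by linarith)
    have hσ : (0 : ℝ) < 1 / 2 * δ₀ := by positivity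
    rw [div_lt_iff₀ hσ] at hN₀ge
    push_cast
    nlinarith [mul_nonneg (by positivity : (0 : ℝ) ≤ 2 * ((d : ℝ) + 1)) (Real.log_nonneg hL1)]
  set cK : ℝ := K261 N₀ (d + 1) ((ℓ : ℝ) + 1) 1 (1 / 2 * δ₀) with hcK
  have hcK0 : 0 ≤ cK := K261_nonneg (by positivity) zero_le_one
  refine ⟨δ₀, M₀V, N₀, hδ₀pos, hM₀V, hN₀pos, fun α hα0 hα1 => ?_⟩
  obtain ⟨AZ, hAZ, hZ⟩ := hZA α hα0 hα1
  obtain ⟨AΨ, hAΨ, hΨ⟩ := hΨA α hα0 hα1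
  refine ⟨AZ + AΨ * CV * cK + 1, by positivity, ?_⟩
  intro k Mh R hMh hM hR hRM P hP hP4 D a c haw hcw hac μ
  have hMh1 : 1 ≤ Mh := le_trans (by norm_num) hMh
  have hMhr : (1 : ℝ) ≤ Mh := by exact_mod_cast hMh1
  have hMh0 : (0 : ℝ) < Mh := by linarith
  have hRMV : N₀V + 1 ≤ R * ((ℓ + 1) * Mh) := le_trans (by rw [hN₀]; omega) hRM
  have hapos : ∀ j, 1 ≤ j → 0 < a j := fun j hj => lt_of_lt_of_le ha (haw j hj).1
  have hcpos : ∀ j, 1 ≤ j → 0 < c j := fun j hj => lt_of_lt_of_le ha2 (hcw j hj).1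
  -- geometry of the torus
  obtain ⟨-, h261, -, -⟩ := lemma21_torus D hMh1 hP hN₀pos hRM hδ₀pos.le (α := 1 / 2) (by norm_num)
    (by norm_num) hθlt
  obtain ⟨htri, hrefl, hdnn⟩ := triangle_refl_nonneg_T D hMh1 hP
  have hsymm : ∀ a b : (geomT D).Site, (geomT D).dist a b = (geomT D).dist b a := fun a b => by
    show (((bondT D).dist a b : ℕ) : ℝ) = (((bondT D).dist b a : ℕ) : ℝ)
    rw [SimpleGraph.dist_comm]
  have hαδ : (0 : ℝ) ≤ (1 - 1 / 2) * δ₀ := by nlinarith [hδ₀pos.le]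
  -- the majorant of `Ṽ = Λ^{−1}G′∂ᵀ` (third entry on the torus, conjugated), lifted
  have hVmaj := hV k Mh R hMh hM hR hRMV P hP hP4 D a c haw hcw hac μ
  have hVt : HasMajorant (g := geomT D) (blkOf D.toDomains)
      (Matrix.toLin' (levW D.toDomains (-1) * (gmlT (N0 ℓ Mh k P) ℓ k D.lev a * (dT (N0 ℓ Mh k P) μ)ᵀ)))
      (fun y y' => CV * Real.exp (-(δ₀ * (geomT D).dist y y'))) := by
    rw [levW_neg_one_eq]
    refine hasMajorant_mono (g := geomT D) (blkOf D.toDomains)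
      (hasMajorant_diagonal_mul (g := geomT D) (blkOf D.toDomains)
        (fun y : ↥(bset D.toDomains) => (((ℓ : ℝ) + 1) ^ y.1.1)⁻¹) (fun y => by positivity) _ hVmaj) fun y y' => ?_
    have hLy : (0 : ℝ) < ((ℓ : ℝ) + 1) ^ y.1.1 := by positivity
    have hexp : Real.exp (-(δV / 2 * (geomT D).dist y y')) ≤ Real.exp (-(δ₀ * (geomT D).dist y y')) :=
      Real.exp_le_exp.2 (by nlinarith [hdnn y y', hδ₀V])
    calc (((ℓ : ℝ) + 1) ^ y.1.1)⁻¹ * (CV * ((ℓ : ℝ) + 1) ^ y.1.1 * Real.exp (-(δV / 2 * (geomT D).dist y y')))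
        = CV * Real.exp (-(δV / 2 * (geomT D).dist y y')) := by field_simp
      _ ≤ CV * Real.exp (-(δ₀ * (geomT D).dist y y')) := mul_le_mul_of_nonneg_left hexp hCV.le
  have hVlift := hasMajorant_liftR (g := geomT D) (blkOf D.toDomains) (blkBT D)
    (K := fun y y' => CV * Real.exp (-(δ₀ * (geomT D).dist y y'))) (fun y y' => by positivity) hVt
  -- the majorants of the lifted `Ψ` and `T₀` (pair rows, §2)
  have hΨm : HasMajorant (g := geomT D) (Sum.elim (blkBT D) (blkOf D.toDomains))
      (liftL (dualOpT D α ((rT D a c hP hP4)ᵀ * levW D.toDomains 1)))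
      (fun y y' => AΨ / Mh * (((ℓ : ℝ) + 1) ^ y.1.1) ^ (1 - α)
        * Real.exp (-((1 - 1 / 2) * δ₀ * (geomT D).dist y y'))) := by
    refine hasMajorant_liftL (g := geomT D) (blkOf D.toDomains) (blkBT D)
      (K := fun y y' => AΨ / Mh * (((ℓ : ℝ) + 1) ^ y.1.1) ^ (1 - α)
        * Real.exp (-((1 - 1 / 2) * δ₀ * (geomT D).dist y y')))
      (fun y y' => by positivity) fun y' lam B hlam p => ?_
    refine (hΨ k Mh R hMh hR P hP hP4 D a c haw hcw y' lam B hlam p).trans ?_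
    refine mul_le_mul_of_nonneg_right (mul_le_mul_of_nonneg_left (Real.exp_le_exp.2 ?_) (by positivity)) hlam.nonneg
    have h1 : (1 - 1 / 2) * δ₀ ≤ δΨ / (d + 1) := by linarith
    nlinarith [hdnn (blkBT D p) y', h1]
  have hZm : HasMajorant (g := geomT D) (Sum.elim (blkBT D) (blkOf D.toDomains))
      (liftL (dualOpT D α ((gZeroT D a c hP hP4)ᵀ * (dT (N0 ℓ Mh k P) μ)ᵀ)))
      (fun y y' => AZ * (((ℓ : ℝ) + 1) ^ y.1.1) ^ (1 - α)
        * Real.exp (-((1 - 1 / 2) * δ₀ * (geomT D).dist y y'))) := by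
    refine hasMajorant_liftL (g := geomT D) (blkOf D.toDomains) (blkBT D)
      (K := fun y y' => AZ * (((ℓ : ℝ) + 1) ^ y.1.1) ^ (1 - α)
        * Real.exp (-((1 - 1 / 2) * δ₀ * (geomT D).dist y y')))
      (fun y y' => by positivity) fun y' lam B hlam p => ?_
    refine (hZ k Mh R hMh hR P hP hP4 D a c haw hcw μ y' lam B hlam p).trans ?_
    refine mul_le_mul_of_nonneg_right (mul_le_mul_of_nonneg_left (Real.exp_le_exp.2 ?_) (by positivity)) hlam.nonneg
    have h1 : (1 - 1 / 2) * δ₀ ≤ δZ / (d + 1) := by linarith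
    nlinarith [hdnn (blkBT D p) y', h1]
  -- the product `Ψ·Ṽ` and the left convolution
  have hprod := hasMajorant_mul (g := geomT D) (Sum.elim (blkBT D) (blkOf D.toDomains))
    (K₂ := fun y y' => CV * Real.exp (-(δ₀ * (geomT D).dist y y'))) hΨm hVlift
    (fun y y' => mul_nonneg hCV.le (Real.exp_pos _).le)
  have hprod' : HasMajorant (g := geomT D) (Sum.elim (blkBT D) (blkOf D.toDomains))
      (liftL (dualOpT D α ((rT D a c hP hP4)ᵀ * levW D.toDomains 1))
        * liftR (Matrix.toLin' (levW D.toDomains (-1) * (gmlT (N0 ℓ Mh k P) ℓ k D.lev a * (dT (N0 ℓ Mh k P) μ)ᵀ))))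
      (fun y y' => AΨ / Mh * (((ℓ : ℝ) + 1) ^ y.1.1) ^ (1 - α) * CV * cK
        * Real.exp (-((1 - 1 / 2) * δ₀ * (geomT D).dist y y'))) :=
    hasMajorant_mono (g := geomT D) (Sum.elim (blkBT D) (blkOf D.toDomains)) hprod fun y y' =>
      conv_left_le hαδ htri hsymm h261 (r := AΨ / Mh * (((ℓ : ℝ) + 1) ^ y.1.1) ^ (1 - α)) (A := CV)
        (by positivity) hCV.le y y'
  -- the lifted identity and the sum
  rw [dual_identityT D (c := c) hℓ hR hP hP4 hMh1 hapos hcpos hac α ((dT (N0 ℓ Mh k P) μ)ᵀ)]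
  have hsum := hasMajorant_add (g := geomT D) (Sum.elim (blkBT D) (blkOf D.toDomains)) hZm hprod'
  refine hasMajorant_mono (g := geomT D) (Sum.elim (blkBT D) (blkOf D.toDomains)) hsum fun y y' => ?_
  have he : Real.exp (-((1 - 1 / 2) * δ₀ * (geomT D).dist y y')) = Real.exp (-(δ₀ / 2 * (geomT D).dist y y')) := by
    congr 1; ring
  rw [he]
  have hP0 : 0 ≤ (((ℓ : ℝ) + 1) ^ y.1.1) ^ (1 - α) := Real.rpow_nonneg (by positivity) _
  have he0 : 0 ≤ Real.exp (-(δ₀ / 2 * (geomT D).dist y y')) := (Real.exp_pos _).le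
  have h1 : AΨ / Mh ≤ AΨ := div_le_self hAΨ.le hMhr
  have h2 : AΨ / Mh * (CV * cK) ≤ AΨ * (CV * cK) := mul_le_mul_of_nonneg_right h1 (mul_nonneg hCV.le hcK0)
  calc AZ * (((ℓ : ℝ) + 1) ^ y.1.1) ^ (1 - α) * Real.exp (-(δ₀ / 2 * (geomT D).dist y y'))
        + AΨ / Mh * (((ℓ : ℝ) + 1) ^ y.1.1) ^ (1 - α) * CV * cK * Real.exp (-(δ₀ / 2 * (geomT D).dist y y'))
      = (AZ + AΨ / Mh * (CV * cK)) * ((((ℓ : ℝ) + 1) ^ y.1.1) ^ (1 - α) * Real.exp (-(δ₀ / 2 * (geomT D).dist y y'))) := by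
        ring
    _ ≤ (AZ + AΨ * CV * cK + 1) * ((((ℓ : ℝ) + 1) ^ y.1.1) ^ (1 - α) * Real.exp (-(δ₀ / 2 * (geomT D).dist y y'))) :=
        mul_le_mul_of_nonneg_right (by linarith) (mul_nonneg hP0 he0)
    _ = (AZ + AΨ * CV * cK + 1) * (((ℓ : ℝ) + 1) ^ y.1.1) ^ (1 - α) * Real.exp (-(δ₀ / 2 * (geomT D).dist y y')) := by
        ring

/-- the same at a fixed `α` (the per-`α` form). [cite: Balaban1984PropagatorsII, Proposition 2.2 (2.67) p.234 (fifth entry), (2.64)–(2.66) p.234] -/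
theorem hasMajorant_dualHolder_multiLevelTorus (d ℓ : ℕ) (hℓ : 1 ≤ ℓ) (aminus aplus a2minus a2plus : ℝ)
    (ha : 0 < aminus) (ha2 : 0 < a2minus) (α : ℝ) (hα0 : 0 ≤ α) (hα1 : α < 1) :
    ∃ δ₀ C M₀ : ℝ, ∃ N₀ : ℕ, 0 < δ₀ ∧ 0 < C ∧ 0 < M₀ ∧ 0 < N₀ ∧
      ∀ (k Mh R : ℕ), 3 ≤ Mh → M₀ ≤ ((ℓ : ℝ) + 1) * Mh → 2 * (ℓ + 1) ≤ R → N₀ + 1 ≤ R * ((ℓ + 1) * Mh) →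
      ∀ (P : Fin (d + 1) → ℕ) (hP : ∀ μ, 1 ≤ P μ) (hP4 : ∀ μ, 4 ≤ P μ) (D : TDomains d ℓ Mh k P R) (a c : ℕ → ℝ),
        (∀ i, 1 ≤ i → aminus ≤ a i ∧ a i ≤ aplus) → (∀ i, 1 ≤ i → a2minus ≤ c i ∧ c i ≤ a2plus) →
        (∀ i, 1 ≤ i → a (i + 1) = aNext ℓ (a i) (c i)) → ∀ μ : Fin (d + 1),
        HasMajorant (g := geomT D) (Sum.elim (blkBT D) (blkOf D.toDomains))
          (liftL (dualOpT D α (gmlT (N0 ℓ Mh k P) ℓ k D.lev a * (dT (N0 ℓ Mh k P) μ)ᵀ)))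
          (fun y y' => C * (((ℓ : ℝ) + 1) ^ y.1.1) ^ (1 - α) * Real.exp (-(δ₀ / 2 * (geomT D).dist y y'))) := by
  obtain ⟨δ₀, M₀, N₀, hδ₀, hM₀, hN₀, h⟩ :=
    hasMajorant_dualHolder_multiLevelTorus_unif d ℓ hℓ aminus aplus a2minus a2plus ha ha2
  obtain ⟨C, hC, h'⟩ := h α hα0 hα1
  exact ⟨δ₀, C, M₀, N₀, hδ₀, hC, hM₀, hN₀, h'⟩

/-- **[B6] PROPOSITION 2.2, FIFTH ENTRY OF (2.67) (`‖ζG′∇^{η*}λ‖_α`), FOR THE GENUINE `k`-LEVEL OPERATOR `G′ = Δ′_a^{−1}`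
ON THE TORUS `T_η`, ONE RATE AND ONE THRESHOLD FOR ALL `α`** (print's carrier, `Ω₁ = T_η`): there are `δ₀, M₀ > 0` and
`N₀ ≥ 1` (functions of `d`, `ℓ`, the windows — NOT of the torus, NOT of `α`) and for every `0 ≤ α < 1` a `C_α > 0` such
that for EVERY number of levels `k`, `M_h ≥ 3` with `L·M_h ≥ M₀` («M is sufficiently large»), `R ≥ 2L` with
`RM ≥ N₀ + 1` ((2.59)), torus size `P` (`P_μ ≥ 4`), nested family `D` of domains of the torus (2.1)–(2.2), weights
`a_i ∈ [a₋, a₊]`, `c_i ∈ [c₋, c₊]` with `a_{i+1} = aNext ℓ a_i c_i`, axis `μ`, and all `x ≠ x̂` of one block `B^j(y)`: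
`|x̂−x|_T^{−α}·|(G′∂_μᵀλ)(x̂) − (G′∂_μᵀλ)(x)| ≤ C_α·(L^{j})^{1−α}·e^{−½δ₀d_T(y,y′)}·|λ|`, `supp λ ⊂ B^{j′}(y′)` (periodic
`∂_μ`; lattice units; torus sup-distance Hölder weight; `ζ` and `(‖ζ‖_α + |ζ|)` dispensed with as in [3] (1.9)) — the
printed route with the box lineage's `α`-uniform per-term rates (`aXt_dd_le_unif`, `bXt_dd_le_unif`). [cite: Balaban1984PropagatorsII, Proposition 2.2 (2.67) p.234 (fifth entry «(L^jη)^{1−α}(‖ζ‖_α + |ζ|)»), (2.64)–(2.66) p.234, p.224 (Ω₁ = T_η admitted); Balaban1983RegularityDecay, Theorem (1.9) p.573] -/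
theorem prop22_fifth_multiLevelTorus_unif (d ℓ : ℕ) (hℓ : 1 ≤ ℓ) (aminus aplus a2minus a2plus : ℝ)
    (ha : 0 < aminus) (ha2 : 0 < a2minus) :
    ∃ δ₀ M₀ : ℝ, ∃ N₀ : ℕ, 0 < δ₀ ∧ 0 < M₀ ∧ 0 < N₀ ∧ ∀ (α : ℝ), 0 ≤ α → α < 1 → ∃ C : ℝ, 0 < C ∧
      ∀ (k Mh R : ℕ), 3 ≤ Mh → M₀ ≤ ((ℓ : ℝ) + 1) * Mh → 2 * (ℓ + 1) ≤ R → N₀ + 1 ≤ R * ((ℓ + 1) * Mh) →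
      ∀ (P : Fin (d + 1) → ℕ) (hP : ∀ μ, 1 ≤ P μ) (hP4 : ∀ μ, 4 ≤ P μ) (D : TDomains d ℓ Mh k P R) (a c : ℕ → ℝ),
        (∀ i, 1 ≤ i → aminus ≤ a i ∧ a i ≤ aplus) → (∀ i, 1 ≤ i → a2minus ≤ c i ∧ c i ≤ a2plus) →
        (∀ i, 1 ≤ i → a (i + 1) = aNext ℓ (a i) (c i)) →
        ∀ (μ : Fin (d + 1)) (y' : ↥(bset D.toDomains)) (lam : ↥(boxDom (N0 ℓ Mh k P)) → ℝ) (B : ℝ),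
          BlockSupp (g := geomT D) (blkOf D.toDomains) lam y' B →
          ∀ (x x' : ↥(boxDom (N0 ℓ Mh k P))), x'.1 ≠ x.1 → blkOf D.toDomains x' = blkOf D.toDomains x →
            (torusSupNorm (N0 ℓ Mh k P) (x'.1 - x.1)) ^ (-α)
                * |((gmlT (N0 ℓ Mh k P) ℓ k D.lev a * (dT (N0 ℓ Mh k P) μ)ᵀ) *ᵥ lam) x'
                    - ((gmlT (N0 ℓ Mh k P) ℓ k D.lev a * (dT (N0 ℓ Mh k P) μ)ᵀ) *ᵥ lam) x|
              ≤ C * (((ℓ : ℝ) + 1) ^ D.lev x.1) ^ (1 - α)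
                * Real.exp (-(δ₀ / 2 * (geomT D).dist (blkOf D.toDomains x) y')) * B := by
  obtain ⟨δ₀, M₀, N₀, hδ₀, hM₀, hN₀, hCA⟩ :=
    hasMajorant_dualHolder_multiLevelTorus_unif d ℓ hℓ aminus aplus a2minus a2plus ha ha2
  refine ⟨δ₀, M₀, N₀, hδ₀, hM₀, hN₀, fun α hα0 hα1 => ?_⟩
  obtain ⟨C, hC, h⟩ := hCA α hα0 hα1
  refine ⟨C, hC, ?_⟩
  intro k Mh R hMh hM hR hRM P hP hP4 D a c haw hcw hac μ y' lam B hlam x x' hne hblk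
  have hMh1 : 1 ≤ Mh := le_trans (by norm_num) hMh
  have hmaj := h k Mh R hMh hM hR hRM P hP hP4 D a c haw hcw hac μ
  have hrow := rowBound_of_hasMajorant_liftL (g := geomT D) (blkOf D.toDomains) (blkBT D) hmaj y' lam B hlam
    (⟨x, x', hne, hblk⟩ : BPairT D)
  rw [dualOpT_apply, abs_mul,
    abs_of_nonneg (Real.rpow_nonneg (torusSupNorm_nonneg (one_le_N0 hMh1 hP) _) _)] at hrow
  exact hrow

/-- **[B6] PROPOSITION 2.2, FIFTH ENTRY OF (2.67) (`‖ζG′∇^{η*}λ‖_α`), FOR THE GENUINE `k`-LEVEL OPERATOR `G′ = Δ′_a^{−1}`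
ON THE TORUS `T_η`, AT A FIXED `α`** (print's carrier, `Ω₁ = T_η`): for `0 ≤ α < 1` there are `δ₀, C, M₀ > 0` and
`N₀ ≥ 1` (functions of `d`, `ℓ`, `α`, the windows — NOT of the torus) such that for EVERY `k`, `M_h ≥ 3` with
`L·M_h ≥ M₀`, `R ≥ 2L` with `RM ≥ N₀ + 1`, torus size `P` (`P_μ ≥ 4`), nested family `D`, weights in the windows, axis `μ`,
and all `x ≠ x̂` of one block `B^j(y)`: `|x̂−x|_T^{−α}·|(G′∂_μᵀλ)(x̂) − (G′∂_μᵀλ)(x)| ≤ C·(L^{j})^{1−α}·e^{−½δ₀d_T(y,y′)}·|λ|`,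
`supp λ ⊂ B^{j′}(y′)`. [cite: Balaban1984PropagatorsII, Proposition 2.2 (2.67) p.234 (fifth entry), (2.64)–(2.66) p.234, p.224 (Ω₁ = T_η admitted); Balaban1983RegularityDecay, Theorem (1.9) p.573] -/
theorem prop22_fifth_multiLevelTorus (d ℓ : ℕ) (hℓ : 1 ≤ ℓ) (aminus aplus a2minus a2plus : ℝ) (ha : 0 < aminus)
    (ha2 : 0 < a2minus) (α : ℝ) (hα0 : 0 ≤ α) (hα1 : α < 1) :
    ∃ δ₀ C M₀ : ℝ, ∃ N₀ : ℕ, 0 < δ₀ ∧ 0 < C ∧ 0 < M₀ ∧ 0 < N₀ ∧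
      ∀ (k Mh R : ℕ), 3 ≤ Mh → M₀ ≤ ((ℓ : ℝ) + 1) * Mh → 2 * (ℓ + 1) ≤ R → N₀ + 1 ≤ R * ((ℓ + 1) * Mh) →
      ∀ (P : Fin (d + 1) → ℕ) (hP : ∀ μ, 1 ≤ P μ) (hP4 : ∀ μ, 4 ≤ P μ) (D : TDomains d ℓ Mh k P R) (a c : ℕ → ℝ),
        (∀ i, 1 ≤ i → aminus ≤ a i ∧ a i ≤ aplus) → (∀ i, 1 ≤ i → a2minus ≤ c i ∧ c i ≤ a2plus) →
        (∀ i, 1 ≤ i → a (i + 1) = aNext ℓ (a i) (c i)) →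
        ∀ (μ : Fin (d + 1)) (y' : ↥(bset D.toDomains)) (lam : ↥(boxDom (N0 ℓ Mh k P)) → ℝ) (B : ℝ),
          BlockSupp (g := geomT D) (blkOf D.toDomains) lam y' B →
          ∀ (x x' : ↥(boxDom (N0 ℓ Mh k P))), x'.1 ≠ x.1 → blkOf D.toDomains x' = blkOf D.toDomains x →
            (torusSupNorm (N0 ℓ Mh k P) (x'.1 - x.1)) ^ (-α)
                * |((gmlT (N0 ℓ Mh k P) ℓ k D.lev a * (dT (N0 ℓ Mh k P) μ)ᵀ) *ᵥ lam) x'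
                    - ((gmlT (N0 ℓ Mh k P) ℓ k D.lev a * (dT (N0 ℓ Mh k P) μ)ᵀ) *ᵥ lam) x|
              ≤ C * (((ℓ : ℝ) + 1) ^ D.lev x.1) ^ (1 - α)
                * Real.exp (-(δ₀ / 2 * (geomT D).dist (blkOf D.toDomains x) y')) * B := by
  obtain ⟨δ₀, M₀, N₀, hδ₀, hM₀, hN₀, h⟩ :=
    prop22_fifth_multiLevelTorus_unif d ℓ hℓ aminus aplus a2minus a2plus ha ha2
  obtain ⟨C, hC, h'⟩ := h α hα0 hα1
  exact ⟨δ₀, C, M₀, N₀, hδ₀, hC, hM₀, hN₀, h'⟩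

end Prop22

end

end Literature.MathematicalPhysics.QuantumFieldTheory.Balaban1983to89.B6Prop22DualHolderMultiLevelTorus
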